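import Literature.Probability.Percolation.TwoSetExchange
import Literature.Probability.Percolation.KozmaNitzanPreFKG
import Literature.Probability.LatticeModels.IsoradialPercolation
import HarnessLib

/-!
# The reverse-Harris row `P3_{1/2}` at a port: the van den Berg–Häggström–Kahn split (gain / loss lemmas, every finite weighted graph)

Support file for crux `stmt-CriticalPhenomena-4575` (`NoHeavyLowerTail`), seat `prim-nh-lead-4575` lead gen 131
(`--supports stmt-CriticalPhenomena-4575`; memo `run/shared/lean/prim/prim-nh-lead-4575/FROM-prim-nh-lead-4575-g131-P3HALF-BHK-SPLIT.md`,
INEQ-CLAIMS lead block of 2026-08-24 (gen 131)).  No definitions, no sorries, standard axioms.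

Bond percolation `μ = prodBernoulli w` on a finite vertex type, root `s`, block partner `a`, singleton `b`, port `c`; block `S = {s,a}`,
terminal set `T = {s,a,b}`; `F = (s↔a) ∩ (s↔b)ᶜ` (the pattern `sa|b`), `D = {S ↮ b} = (s↔b)ᶜ ∩ (a↔b)ᶜ` (so `F = D ∩ (s↔a)`),
`c ↔ T = (c↔s) ∪ (c↔a) ∪ (c↔b)`.  The row `P3_{1/2}` (face of the super-terminal quartic `V4`, `…SuperTerminalQuarticFace`) is
`μ(F)·μ(c↔T) ≤ 2·μ(F ∩ c↔T)`, i.e. `P(c↔T ∣ sa|b) ≥ ½·P(c↔T)`; it gives `TCB'_{1/2} ⟹ TCB ⟹ TT-CHORD(E₃)` in the tree.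

THE SPLIT.  On `F` the port is joined to `T` through `s` or (exclusively) through `b`; on `D` through `S` or (exclusively) through `b`.
With the sets `S = {s,a}`, `T' = {b}` the event `{s↔a}` is increasing in the union of open edge clusters `C_S` (closed under enlarging `C_S`),
`{c↔S}` is increasing in `C_S`, and `{c↔b}` is increasing in `C_b`; van den Berg–Häggström–Kahn's conditional association given `{S ↮ b}`
(Thm. 1.5 / 2.1 with vertex sets, tree theorem `setTwoClusterExchange`) therefore yields, on EVERY finite weighted graph:
* `gain` — **`μ(F ∩ c↔s)·μ(D) ≥ μ(F)·μ(D ∩ c↔S)`**, i.e. `P(c↔s ∣ F) ≥ P(c↔S ∣ S↮b)`: conditioning further on `s↔a` can only help the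
  port reach the block;
* `loss` — **`μ(F ∩ c↔b)·μ(D) ≤ μ(F)·μ(D ∩ c↔b)`**, i.e. `P(c↔b ∣ F) ≤ P(c↔b ∣ S↮b)`: it can only hurt the port's attachment to `b`;
* `real_F_inter_connT`, `real_D_inter_connT` — the disjoint decompositions `μ(F ∩ c↔T) = μ(F ∩ c↔s) + μ(F ∩ c↔b)`,
  `μ(D ∩ c↔T) = μ(D ∩ c↔S) + μ(D ∩ c↔b)`;
* `p3_half_of_blockSided` — COROLLARY (unconditional): `P3_{1/2}` holds at every port whose attachment to the block given `S ↮ b` is already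
  half of its attachment to `T`: `2·μ(D ∩ c↔S) ≥ μ(D)·μ(c↔T) ⟹ μ(F)·μ(c↔T) ≤ 2·μ(F ∩ c↔T)`;
* `p3_half_of_gl_of_c` — the reduction schema `GL_λ ∧ C_κ ⟹ P3_{1/2}` for `λκ ≥ ½`, where `GL_λ : μ(F ∩ c↔T)·μ(D) ≥ λ·μ(D ∩ c↔T)·μ(F)` and
  `C_κ : μ(D ∩ c↔T) ≥ κ·μ(D)·μ(c↔T)` (`C_{2/3}` is the three-point face inequality `(C½)` of the glued graph `G/sa`, a theorem of the lane;
  the lead memo shows that the sharp `λ` is the three-point constant `2/3` — contested-vertex embedding — so the schema records the exact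
  bookkeeping `P3 = gain − loss + C-slack`, not a route).
-/

namespace Summit.CriticalPhenomena.PercolationContinuityZ3.Theorems.SuperTerminalP3HalfBHKSplit

open MeasureTheory Set
open Literature.Probability.Percolation Literature.Probability.LatticeModels
open scoped Classical

variable {V : Type*} [Fintype V]

/-! ## Events -/

omit [Fintype V] in
/-- The separation event of van den Berg–Häggström–Kahn for the sets `S = {s,a}`, `T = {b}` is `(s↔b)ᶜ ∩ (a↔b)ᶜ`. [folklore] -/
theorem sep_eq (s a b : V) :
    {ω : BondConfig V | ∀ x ∈ ({s, a} : Set V), ∀ t ∈ ({b} : Set V), ¬ (openGraph ω).Reachable x t} =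
      (openConn s b)ᶜ ∩ (openConn a b)ᶜ := by
  ext ω
  simp only [mem_insert_iff, mem_singleton_iff, forall_eq_or_imp, forall_eq, mem_setOf_eq, mem_inter_iff, mem_compl_iff]
  exact Iff.rfl

omit [Fintype V] in
/-- `F = (s↔a) ∩ (s↔b)ᶜ` equals `D ∩ (s↔a)` with `D = (s↔b)ᶜ ∩ (a↔b)ᶜ`: under `s↔a`, `s↮b` forces `a↮b`. [this work] -/
theorem F_eq (s a b : V) :
    (openConn s a ∩ (openConn s b)ᶜ : Set (BondConfig V)) = (openConn s b)ᶜ ∩ (openConn a b)ᶜ ∩ openConn s a := by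
  ext ω
  simp only [mem_inter_iff, mem_compl_iff]
  constructor
  · rintro ⟨hsa, hsb⟩
    exact ⟨⟨hsb, fun hab => hsb (SimpleGraph.Reachable.trans hsa hab)⟩, hsa⟩
  · rintro ⟨⟨hsb, -⟩, hsa⟩
    exact ⟨hsa, hsb⟩

omit [Fintype V] in
/-- On `F`, the port reaches the block iff it reaches the root: `F ∩ ((c↔s) ∪ (c↔a)) = F ∩ (c↔s)`. [this work] -/
theorem F_inter_connS (s a b c : V) :
    (openConn s a ∩ (openConn s b)ᶜ ∩ (openConn c s ∪ openConn c a) : Set (BondConfig V)) =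
      openConn s a ∩ (openConn s b)ᶜ ∩ openConn c s := by
  ext ω
  simp only [mem_inter_iff, mem_compl_iff, mem_union]
  constructor
  · rintro ⟨⟨hsa, hsb⟩, hc⟩
    refine ⟨⟨hsa, hsb⟩, ?_⟩
    rcases hc with hcs | hca
    · exact hcs
    · exact SimpleGraph.Reachable.trans hca (SimpleGraph.Reachable.symm hsa)
  · rintro ⟨hF, hcs⟩
    exact ⟨hF, Or.inl hcs⟩

omit [Fintype V] in
/-- `c ↔ T` as a union: `((c↔s)ᶜ ∩ (c↔a)ᶜ ∩ (c↔b)ᶜ)ᶜ = (c↔s) ∪ (c↔a) ∪ (c↔b)`. [folklore] -/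
theorem connT_eq (s a b c : V) :
    (((openConn c s)ᶜ ∩ (openConn c a)ᶜ ∩ (openConn c b)ᶜ)ᶜ : Set (BondConfig V)) = openConn c s ∪ openConn c a ∪ openConn c b := by
  rw [compl_inter, compl_inter, compl_compl, compl_compl, compl_compl]

/-! ## The disjoint decompositions -/

/-- On `F` the port cannot reach both the root and `b` (else `s ↔ b`): `μ(F ∩ c↔T) = μ(F ∩ c↔s) + μ(F ∩ c↔b)`. [this work] -/
theorem real_F_inter_connT (w : Sym2 V → unitInterval) (s a b c : V) :
    (prodBernoulli w).real (openConn s a ∩ (openConn s b)ᶜ ∩ ((openConn c s)ᶜ ∩ (openConn c a)ᶜ ∩ (openConn c b)ᶜ)ᶜ : Set (BondConfig V)) =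
      (prodBernoulli w).real (openConn s a ∩ (openConn s b)ᶜ ∩ openConn c s : Set (BondConfig V)) +
        (prodBernoulli w).real (openConn s a ∩ (openConn s b)ᶜ ∩ openConn c b : Set (BondConfig V)) := by
  have hsplit : (openConn s a ∩ (openConn s b)ᶜ ∩ ((openConn c s)ᶜ ∩ (openConn c a)ᶜ ∩ (openConn c b)ᶜ)ᶜ : Set (BondConfig V)) =
      (openConn s a ∩ (openConn s b)ᶜ ∩ openConn c s) ∪ (openConn s a ∩ (openConn s b)ᶜ ∩ openConn c b) := by
    rw [connT_eq, inter_union_distrib_left, F_inter_connS]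
  have hdisj : Disjoint (openConn s a ∩ (openConn s b)ᶜ ∩ openConn c s : Set (BondConfig V))
      (openConn s a ∩ (openConn s b)ᶜ ∩ openConn c b) := by
    rw [Set.disjoint_left]
    rintro ω ⟨⟨-, hsb⟩, hcs⟩ ⟨-, hcb⟩
    exact hsb (SimpleGraph.Reachable.trans (SimpleGraph.Reachable.symm hcs) hcb)
  rw [hsplit, measureReal_union hdisj MeasurableSet.of_discrete]

/-- On `D = {S ↮ b}` the port cannot reach both the block and `b`: `μ(D ∩ c↔T) = μ(D ∩ ((c↔s) ∪ (c↔a))) + μ(D ∩ c↔b)`. [this work] -/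
theorem real_D_inter_connT (w : Sym2 V → unitInterval) (s a b c : V) :
    (prodBernoulli w).real ((openConn s b)ᶜ ∩ (openConn a b)ᶜ ∩ ((openConn c s)ᶜ ∩ (openConn c a)ᶜ ∩ (openConn c b)ᶜ)ᶜ : Set (BondConfig V)) =
      (prodBernoulli w).real ((openConn s b)ᶜ ∩ (openConn a b)ᶜ ∩ (openConn c s ∪ openConn c a) : Set (BondConfig V)) +
        (prodBernoulli w).real ((openConn s b)ᶜ ∩ (openConn a b)ᶜ ∩ openConn c b : Set (BondConfig V)) := by
  have hsplit : ((openConn s b)ᶜ ∩ (openConn a b)ᶜ ∩ ((openConn c s)ᶜ ∩ (openConn c a)ᶜ ∩ (openConn c b)ᶜ)ᶜ : Set (BondConfig V)) =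
      ((openConn s b)ᶜ ∩ (openConn a b)ᶜ ∩ (openConn c s ∪ openConn c a)) ∪ ((openConn s b)ᶜ ∩ (openConn a b)ᶜ ∩ openConn c b) := by
    rw [connT_eq, inter_union_distrib_left]
  have hdisj : Disjoint ((openConn s b)ᶜ ∩ (openConn a b)ᶜ ∩ (openConn c s ∪ openConn c a) : Set (BondConfig V))
      ((openConn s b)ᶜ ∩ (openConn a b)ᶜ ∩ openConn c b) := by
    rw [Set.disjoint_left]
    rintro ω ⟨⟨hsb, hab⟩, hc⟩ ⟨-, hcb⟩
    rcases hc with hcs | hca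
    · exact hsb (SimpleGraph.Reachable.trans (SimpleGraph.Reachable.symm hcs) hcb)
    · exact hab (SimpleGraph.Reachable.trans (SimpleGraph.Reachable.symm hca) hcb)
  rw [hsplit, measureReal_union hdisj MeasurableSet.of_discrete]

/-! ## The two applications of van den Berg–Häggström–Kahn (2006), Thm. 1.5 with vertex sets -/

/-- **GAIN (every finite weighted graph).**  `μ(F)·μ(D ∩ ((c↔s) ∪ (c↔a))) ≤ μ(F ∩ c↔s)·μ(D)` with `F = (s↔a) ∩ (s↔b)ᶜ`,
`D = (s↔b)ᶜ ∩ (a↔b)ᶜ`: given `{s,a} ↮ b`, conditioning further on `s ↔ a` does not decrease the probability that the port reaches the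
block (both events are increasing in the open edge cluster of `{s,a}`; van den Berg–Häggström–Kahn 2006, Thm. 1.5 with sets). [this work] -/
theorem gain (w : Sym2 V → unitInterval) (s a b c : V) :
    (prodBernoulli w).real (openConn s a ∩ (openConn s b)ᶜ : Set (BondConfig V)) *
        (prodBernoulli w).real ((openConn s b)ᶜ ∩ (openConn a b)ᶜ ∩ (openConn c s ∪ openConn c a) : Set (BondConfig V)) ≤
      (prodBernoulli w).real (openConn s a ∩ (openConn s b)ᶜ ∩ openConn c s : Set (BondConfig V)) *
        (prodBernoulli w).real ((openConn s b)ᶜ ∩ (openConn a b)ᶜ : Set (BondConfig V)) := by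
  have hs : s ∈ ({s, a} : Set V) := mem_insert s {a}
  have key := setTwoClusterExchange w ({s, a} : Set V) ({b} : Set V)
    (A₁ := openConn s a) (A₂ := ⋃ x ∈ ({s, a} : Set V), (openConn x c : Set (BondConfig V))) (B₁ := univ) (B₂ := univ)
    (TwoSetExchange.typePlus_openConn_of_mem {s, a} {b} hs a)
    (TwoSetExchange.typePlus_biUnion_openConn {s, a} {b} c)
    (fun _ ω' _ _ _ => mem_univ ω') (fun _ ω' _ _ _ => mem_univ ω')
  simp only [sep_eq, biUnion_insert, biUnion_singleton, inter_univ] at key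
  -- `key : μ(D ∩ (s↔a)) · μ(D ∩ ((s↔c) ∪ (a↔c))) ≤ μ(D ∩ ((s↔a) ∩ ((s↔c) ∪ (a↔c)))) · μ(D)`
  rw [KNPreFKG.openConn_symm s c, KNPreFKG.openConn_symm a c] at key
  have hF : (openConn s a ∩ (openConn s b)ᶜ : Set (BondConfig V)) = (openConn s b)ᶜ ∩ (openConn a b)ᶜ ∩ openConn s a := F_eq s a b
  have hFc : (openConn s a ∩ (openConn s b)ᶜ ∩ openConn c s : Set (BondConfig V)) =
      (openConn s b)ᶜ ∩ (openConn a b)ᶜ ∩ (openConn s a ∩ (openConn c s ∪ openConn c a)) := by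
    rw [← F_inter_connS, hF, inter_assoc]
  rw [hFc, hF]
  exact key

/-- **LOSS (every finite weighted graph).**  `μ(F ∩ c↔b)·μ(D) ≤ μ(F)·μ(D ∩ c↔b)` with `F = (s↔a) ∩ (s↔b)ᶜ`, `D = (s↔b)ᶜ ∩ (a↔b)ᶜ`:
given `{s,a} ↮ b`, conditioning further on `s ↔ a` does not increase the probability that the port reaches `b` (`{s↔a}` is increasing in
the cluster of `{s,a}`, `{c↔b}` in the cluster of `b`; van den Berg–Häggström–Kahn 2006, Thm. 1.4/1.5 with sets). [this work] -/
theorem loss (w : Sym2 V → unitInterval) (s a b c : V) :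
    (prodBernoulli w).real (openConn s a ∩ (openConn s b)ᶜ ∩ openConn c b : Set (BondConfig V)) *
        (prodBernoulli w).real ((openConn s b)ᶜ ∩ (openConn a b)ᶜ : Set (BondConfig V)) ≤
      (prodBernoulli w).real (openConn s a ∩ (openConn s b)ᶜ : Set (BondConfig V)) *
        (prodBernoulli w).real ((openConn s b)ᶜ ∩ (openConn a b)ᶜ ∩ openConn c b : Set (BondConfig V)) := by
  have hs : s ∈ ({s, a} : Set V) := mem_insert s {a}
  have key := setTwoClusterExchange w ({s, a} : Set V) ({b} : Set V)
    (A₁ := openConn s a) (A₂ := univ) (B₁ := ⋃ t ∈ ({b} : Set V), (openConn t c : Set (BondConfig V))) (B₂ := univ)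
    (TwoSetExchange.typePlus_openConn_of_mem {s, a} {b} hs a)
    (fun _ ω' _ _ _ => mem_univ ω')
    (TwoSetExchange.typeMinus_biUnion_openConn {s, a} {b} c)
    (fun _ ω' _ _ _ => mem_univ ω')
  simp only [sep_eq, biUnion_singleton, inter_univ] at key
  -- `key : μ(D ∩ ((s↔a) ∩ (b↔c))) · μ(D) ≤ μ(D ∩ (s↔a)) · μ(D ∩ (b↔c))`
  rw [KNPreFKG.openConn_symm b c] at key
  have hF : (openConn s a ∩ (openConn s b)ᶜ : Set (BondConfig V)) = (openConn s b)ᶜ ∩ (openConn a b)ᶜ ∩ openConn s a := F_eq s a b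
  have hFc : (openConn s a ∩ (openConn s b)ᶜ ∩ openConn c b : Set (BondConfig V)) =
      (openConn s b)ᶜ ∩ (openConn a b)ᶜ ∩ (openConn s a ∩ openConn c b) := by
    rw [hF, inter_assoc]
  rw [hFc, hF]
  exact key

/-! ## Consequences for `P3_{1/2}` -/

/-- **`P3_{1/2}` at block-sided ports (unconditional, every finite weighted graph).**  If, given `{s,a} ↮ b`, the port reaches the block
with at least half of its unconditional probability of reaching `T = {s,a,b}` — `2·μ(D ∩ ((c↔s) ∪ (c↔a))) ≥ μ(D)·μ(c↔T)` — then
`μ(F)·μ(c↔T) ≤ 2·μ(F ∩ c↔T)` (`P3_{1/2}`).  Proof: `gain` and monotonicity. [this work] -/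
theorem p3_half_of_blockSided (w : Sym2 V → unitInterval) (s a b c : V)
    (h : (prodBernoulli w).real ((openConn s b)ᶜ ∩ (openConn a b)ᶜ : Set (BondConfig V)) *
        (prodBernoulli w).real ((openConn c s)ᶜ ∩ (openConn c a)ᶜ ∩ (openConn c b)ᶜ : Set (BondConfig V))ᶜ ≤
      2 * (prodBernoulli w).real ((openConn s b)ᶜ ∩ (openConn a b)ᶜ ∩ (openConn c s ∪ openConn c a) : Set (BondConfig V))) :
    (prodBernoulli w).real (openConn s a ∩ (openConn s b)ᶜ : Set (BondConfig V)) *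
        (prodBernoulli w).real ((openConn c s)ᶜ ∩ (openConn c a)ᶜ ∩ (openConn c b)ᶜ : Set (BondConfig V))ᶜ ≤
      2 * (prodBernoulli w).real (openConn s a ∩ (openConn s b)ᶜ ∩ ((openConn c s)ᶜ ∩ (openConn c a)ᶜ ∩ (openConn c b)ᶜ)ᶜ : Set (BondConfig V)) := by
  set μ := prodBernoulli w with hμ
  have hmono : ∀ {X Y : Set (BondConfig V)}, X ⊆ Y → μ.real X ≤ μ.real Y := fun hXY =>
    measureReal_mono hXY (measure_ne_top μ _)
  set f := μ.real (openConn s a ∩ (openConn s b)ᶜ : Set (BondConfig V)) with hf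
  set d := μ.real ((openConn s b)ᶜ ∩ (openConn a b)ᶜ : Set (BondConfig V)) with hd
  set k := μ.real ((openConn c s)ᶜ ∩ (openConn c a)ᶜ ∩ (openConn c b)ᶜ : Set (BondConfig V))ᶜ with hk
  set gS := μ.real ((openConn s b)ᶜ ∩ (openConn a b)ᶜ ∩ (openConn c s ∪ openConn c a) : Set (BondConfig V)) with hgS
  set ms := μ.real (openConn s a ∩ (openConn s b)ᶜ ∩ openConn c s : Set (BondConfig V)) with hms
  set m := μ.real (openConn s a ∩ (openConn s b)ᶜ ∩ ((openConn c s)ᶜ ∩ (openConn c a)ᶜ ∩ (openConn c b)ᶜ)ᶜ : Set (BondConfig V)) with hm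
  have hgain : f * gS ≤ ms * d := gain w s a b c
  have hms_le : ms ≤ m := by
    apply hmono
    rintro ω ⟨hF, hcs⟩
    refine ⟨hF, ?_⟩
    rw [connT_eq]
    exact Or.inl (Or.inl hcs)
  have hf0 : 0 ≤ f := measureReal_nonneg
  have hk0 : 0 ≤ k := measureReal_nonneg
  have hd0 : 0 ≤ d := measureReal_nonneg
  have hfd : f ≤ d := by
    apply hmono
    intro ω hω
    rw [F_eq] at hω
    exact hω.1
  -- if `μ(D) = 0` then `μ(F) = 0`; otherwise divide `2 f gS ≤ 2 m d` and `d k ≤ 2 gS` by `d`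
  rcases eq_or_lt_of_le hd0 with hd00 | hdpos
  · have hf00 : f = 0 := le_antisymm (hd00 ▸ hfd) hf0
    rw [hf00, zero_mul]
    have : 0 ≤ m := measureReal_nonneg
    linarith
  · have h1 : f * (d * k) ≤ f * (2 * gS) := mul_le_mul_of_nonneg_left h hf0
    have h2 : f * (2 * gS) ≤ 2 * (m * d) := by nlinarith [hgain, hms_le, hd0]
    have h3 : d * (f * k) ≤ d * (2 * m) := by nlinarith [h1, h2]
    exact le_of_mul_le_mul_left h3 hdpos

omit [Fintype V] in
/-- **The reduction schema `GL_λ ∧ C_κ ⟹ P3_{1/2}` (`λκ ≥ ½`).**  If `μ(F ∩ c↔T)·μ(D) ≥ λ·μ(D ∩ c↔T)·μ(F)` (conditioning on `s↔a`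
given `{s,a}↮b` keeps at least the fraction `λ` of the port's attachment to `T`) and `μ(D ∩ c↔T) ≥ κ·μ(D)·μ(c↔T)` (the three-point
face inequality of the glued graph `G/sa` with constant `κ`), with `λ ≥ 0` and `λκ ≥ ½`, then `μ(F)·μ(c↔T) ≤ 2·μ(F ∩ c↔T)`. [this work] -/
theorem p3_half_of_gl_of_c (w : Sym2 V → unitInterval) (s a b c : V) {lam kap : ℝ} (hlam : 0 ≤ lam) (hlk : 1 / 2 ≤ lam * kap)
    (hGL : lam * ((prodBernoulli w).real ((openConn s b)ᶜ ∩ (openConn a b)ᶜ ∩ ((openConn c s)ᶜ ∩ (openConn c a)ᶜ ∩ (openConn c b)ᶜ)ᶜ : Set (BondConfig V)) *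
        (prodBernoulli w).real (openConn s a ∩ (openConn s b)ᶜ : Set (BondConfig V))) ≤
      (prodBernoulli w).real (openConn s a ∩ (openConn s b)ᶜ ∩ ((openConn c s)ᶜ ∩ (openConn c a)ᶜ ∩ (openConn c b)ᶜ)ᶜ : Set (BondConfig V)) *
        (prodBernoulli w).real ((openConn s b)ᶜ ∩ (openConn a b)ᶜ : Set (BondConfig V)))
    (hC : kap * ((prodBernoulli w).real ((openConn s b)ᶜ ∩ (openConn a b)ᶜ : Set (BondConfig V)) *
        (prodBernoulli w).real ((openConn c s)ᶜ ∩ (openConn c a)ᶜ ∩ (openConn c b)ᶜ : Set (BondConfig V))ᶜ) ≤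
      (prodBernoulli w).real ((openConn s b)ᶜ ∩ (openConn a b)ᶜ ∩ ((openConn c s)ᶜ ∩ (openConn c a)ᶜ ∩ (openConn c b)ᶜ)ᶜ : Set (BondConfig V))) :
    (prodBernoulli w).real (openConn s a ∩ (openConn s b)ᶜ : Set (BondConfig V)) *
        (prodBernoulli w).real ((openConn c s)ᶜ ∩ (openConn c a)ᶜ ∩ (openConn c b)ᶜ : Set (BondConfig V))ᶜ ≤
      2 * (prodBernoulli w).real (openConn s a ∩ (openConn s b)ᶜ ∩ ((openConn c s)ᶜ ∩ (openConn c a)ᶜ ∩ (openConn c b)ᶜ)ᶜ : Set (BondConfig V)) := by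
  set μ := prodBernoulli w with hμ
  have hmono : ∀ {X Y : Set (BondConfig V)}, X ⊆ Y → μ.real X ≤ μ.real Y := fun hXY =>
    measureReal_mono hXY (measure_ne_top μ _)
  set f := μ.real (openConn s a ∩ (openConn s b)ᶜ : Set (BondConfig V)) with hf
  set d := μ.real ((openConn s b)ᶜ ∩ (openConn a b)ᶜ : Set (BondConfig V)) with hd
  set k := μ.real ((openConn c s)ᶜ ∩ (openConn c a)ᶜ ∩ (openConn c b)ᶜ : Set (BondConfig V))ᶜ with hk
  set n := μ.real ((openConn s b)ᶜ ∩ (openConn a b)ᶜ ∩ ((openConn c s)ᶜ ∩ (openConn c a)ᶜ ∩ (openConn c b)ᶜ)ᶜ : Set (BondConfig V)) with hn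
  set m := μ.real (openConn s a ∩ (openConn s b)ᶜ ∩ ((openConn c s)ᶜ ∩ (openConn c a)ᶜ ∩ (openConn c b)ᶜ)ᶜ : Set (BondConfig V)) with hm
  have hf0 : 0 ≤ f := measureReal_nonneg
  have hk0 : 0 ≤ k := measureReal_nonneg
  have hd0 : 0 ≤ d := measureReal_nonneg
  have hm0 : 0 ≤ m := measureReal_nonneg
  have hn0 : 0 ≤ n := measureReal_nonneg
  have hfd : f ≤ d := by
    apply hmono
    intro ω hω
    rw [F_eq] at hω
    exact hω.1
  rcases eq_or_lt_of_le hd0 with hd00 | hdpos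
  · have hf00 : f = 0 := le_antisymm (hd00 ▸ hfd) hf0
    rw [hf00, zero_mul]
    linarith
  · -- `d·(f k) ≤ d·(2 m)`: from `λκ·(d k f) ≤ λ·(n f) ≤ m d` and `½ ≤ λκ`
    have h1 : lam * kap * (d * k * f) ≤ lam * (n * f) := by
      have := mul_le_mul_of_nonneg_left (mul_le_mul_of_nonneg_right hC hf0) hlam
      nlinarith [this]
    have h2 : lam * (n * f) ≤ m * d := by nlinarith [hGL]
    have h3 : 1 / 2 * (d * k * f) ≤ lam * kap * (d * k * f) := mul_le_mul_of_nonneg_right hlk (by positivity)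
    have h4 : d * (f * k) ≤ d * (2 * m) := by nlinarith [h1, h2, h3]
    exact le_of_mul_le_mul_left h4 hdpos

/-! ## Appendix (lead gen 131, second landing): the one-vertex comparison — conditioning on `s ↮ b` only

The same two applications of van den Berg–Häggström–Kahn with the SINGLE source `s` (sets `S = {s}`, `T' = {b}`, separation event `D₃ = (s↔b)ᶜ`,
`F = D₃ ∩ (s↔a)`): `{s↔a}` and `{c↔s}` are increasing in `C_s`, `{c↔b}` is increasing in `C_b`.  This gives the ROOT-SIDED gain/loss pair
`P(c↔s ∣ F) ≥ P(c↔s ∣ s↮b)`, `P(c↔b ∣ F) ≤ P(c↔b ∣ s↮b)` and, with the `s ↔ a` symmetry of `F` and of `c↔T`, two more unconditional cases of `P3_{1/2}`: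
ports with `2·μ((s↮b) ∩ (c↔s)) ≥ μ(s↮b)·μ(c↔T)` (`p3_half_of_rootSided`) or `2·μ((a↮b) ∩ (c↔a)) ≥ μ(a↮b)·μ(c↔T)` (`p3_half_of_partnerSided`). -/

omit [Fintype V] in
/-- The separation event for `S = {s}`, `T = {b}` is `(s↔b)ᶜ`. [folklore] -/
theorem sep_eq_single (s b : V) :
    {ω : BondConfig V | ∀ x ∈ ({s} : Set V), ∀ t ∈ ({b} : Set V), ¬ (openGraph ω).Reachable x t} = (openConn s b)ᶜ := by
  ext ω
  simp only [mem_singleton_iff, forall_eq, mem_setOf_eq, mem_compl_iff]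
  exact Iff.rfl

/-- **ROOT-SIDED GAIN (every finite weighted graph).**  `μ(F)·μ((s↮b) ∩ (c↔s)) ≤ μ(F ∩ c↔s)·μ(s↮b)`: given `s ↮ b`, conditioning further on
`s ↔ a` does not decrease the probability that the port reaches the root (van den Berg–Häggström–Kahn 2006, Thm. 1.3 with `X = {b}`). [this work] -/
theorem gain_root (w : Sym2 V → unitInterval) (s a b c : V) :
    (prodBernoulli w).real (openConn s a ∩ (openConn s b)ᶜ : Set (BondConfig V)) *
        (prodBernoulli w).real ((openConn s b)ᶜ ∩ openConn c s : Set (BondConfig V)) ≤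
      (prodBernoulli w).real (openConn s a ∩ (openConn s b)ᶜ ∩ openConn c s : Set (BondConfig V)) *
        (prodBernoulli w).real ((openConn s b)ᶜ : Set (BondConfig V)) := by
  have hs : s ∈ ({s} : Set V) := mem_singleton s
  have key := setTwoClusterExchange w ({s} : Set V) ({b} : Set V)
    (A₁ := openConn s a) (A₂ := ⋃ x ∈ ({s} : Set V), (openConn x c : Set (BondConfig V))) (B₁ := univ) (B₂ := univ)
    (TwoSetExchange.typePlus_openConn_of_mem {s} {b} hs a)
    (TwoSetExchange.typePlus_biUnion_openConn {s} {b} c)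
    (fun _ ω' _ _ _ => mem_univ ω') (fun _ ω' _ _ _ => mem_univ ω')
  simp only [sep_eq_single, biUnion_singleton, inter_univ] at key
  rw [KNPreFKG.openConn_symm s c] at key
  -- `key : μ(D₃ ∩ (s↔a)) · μ(D₃ ∩ (c↔s)) ≤ μ(D₃ ∩ ((s↔a) ∩ (c↔s))) · μ(D₃)`
  have hF : (openConn s a ∩ (openConn s b)ᶜ : Set (BondConfig V)) = (openConn s b)ᶜ ∩ openConn s a := inter_comm _ _
  have hFc : (openConn s a ∩ (openConn s b)ᶜ ∩ openConn c s : Set (BondConfig V)) = (openConn s b)ᶜ ∩ (openConn s a ∩ openConn c s) := by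
    rw [hF, inter_assoc]
  rw [hFc, hF]
  exact key

/-- **ROOT-SIDED LOSS (every finite weighted graph).**  `μ(F ∩ c↔b)·μ(s↮b) ≤ μ(F)·μ((s↮b) ∩ (c↔b))`: given `s ↮ b`, conditioning further on
`s ↔ a` does not increase the probability that the port reaches `b` (van den Berg–Häggström–Kahn 2006, Thm. 1.4/1.5). [this work] -/
theorem loss_root (w : Sym2 V → unitInterval) (s a b c : V) :
    (prodBernoulli w).real (openConn s a ∩ (openConn s b)ᶜ ∩ openConn c b : Set (BondConfig V)) *
        (prodBernoulli w).real ((openConn s b)ᶜ : Set (BondConfig V)) ≤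
      (prodBernoulli w).real (openConn s a ∩ (openConn s b)ᶜ : Set (BondConfig V)) *
        (prodBernoulli w).real ((openConn s b)ᶜ ∩ openConn c b : Set (BondConfig V)) := by
  have hs : s ∈ ({s} : Set V) := mem_singleton s
  have key := setTwoClusterExchange w ({s} : Set V) ({b} : Set V)
    (A₁ := openConn s a) (A₂ := univ) (B₁ := ⋃ t ∈ ({b} : Set V), (openConn t c : Set (BondConfig V))) (B₂ := univ)
    (TwoSetExchange.typePlus_openConn_of_mem {s} {b} hs a)
    (fun _ ω' _ _ _ => mem_univ ω')
    (TwoSetExchange.typeMinus_biUnion_openConn {s} {b} c)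
    (fun _ ω' _ _ _ => mem_univ ω')
  simp only [sep_eq_single, biUnion_singleton, inter_univ] at key
  rw [KNPreFKG.openConn_symm b c] at key
  -- `key : μ(D₃ ∩ ((s↔a) ∩ (c↔b))) · μ(D₃) ≤ μ(D₃ ∩ (s↔a)) · μ(D₃ ∩ (c↔b))`
  have hF : (openConn s a ∩ (openConn s b)ᶜ : Set (BondConfig V)) = (openConn s b)ᶜ ∩ openConn s a := inter_comm _ _
  have hFc : (openConn s a ∩ (openConn s b)ᶜ ∩ openConn c b : Set (BondConfig V)) = (openConn s b)ᶜ ∩ (openConn s a ∩ openConn c b) := by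
    rw [hF, inter_assoc]
  rw [hFc, hF]
  exact key

/-- **`P3_{1/2}` at root-sided ports (unconditional, every finite weighted graph).**  If `2·μ((s↮b) ∩ (c↔s)) ≥ μ(s↮b)·μ(c↔T)` then
`μ(F)·μ(c↔T) ≤ 2·μ(F ∩ c↔T)`.  Proof: `gain_root` and monotonicity. [this work] -/
theorem p3_half_of_rootSided (w : Sym2 V → unitInterval) (s a b c : V)
    (h : (prodBernoulli w).real ((openConn s b)ᶜ : Set (BondConfig V)) *
        (prodBernoulli w).real ((openConn c s)ᶜ ∩ (openConn c a)ᶜ ∩ (openConn c b)ᶜ : Set (BondConfig V))ᶜ ≤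
      2 * (prodBernoulli w).real ((openConn s b)ᶜ ∩ openConn c s : Set (BondConfig V))) :
    (prodBernoulli w).real (openConn s a ∩ (openConn s b)ᶜ : Set (BondConfig V)) *
        (prodBernoulli w).real ((openConn c s)ᶜ ∩ (openConn c a)ᶜ ∩ (openConn c b)ᶜ : Set (BondConfig V))ᶜ ≤
      2 * (prodBernoulli w).real (openConn s a ∩ (openConn s b)ᶜ ∩ ((openConn c s)ᶜ ∩ (openConn c a)ᶜ ∩ (openConn c b)ᶜ)ᶜ : Set (BondConfig V)) := by
  set μ := prodBernoulli w with hμ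
  have hmono : ∀ {X Y : Set (BondConfig V)}, X ⊆ Y → μ.real X ≤ μ.real Y := fun hXY =>
    measureReal_mono hXY (measure_ne_top μ _)
  set f := μ.real (openConn s a ∩ (openConn s b)ᶜ : Set (BondConfig V)) with hf
  set d := μ.real ((openConn s b)ᶜ : Set (BondConfig V)) with hd
  set k := μ.real ((openConn c s)ᶜ ∩ (openConn c a)ᶜ ∩ (openConn c b)ᶜ : Set (BondConfig V))ᶜ with hk
  set gS := μ.real ((openConn s b)ᶜ ∩ openConn c s : Set (BondConfig V)) with hgS
  set ms := μ.real (openConn s a ∩ (openConn s b)ᶜ ∩ openConn c s : Set (BondConfig V)) with hms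
  set m := μ.real (openConn s a ∩ (openConn s b)ᶜ ∩ ((openConn c s)ᶜ ∩ (openConn c a)ᶜ ∩ (openConn c b)ᶜ)ᶜ : Set (BondConfig V)) with hm
  have hgain : f * gS ≤ ms * d := gain_root w s a b c
  have hms_le : ms ≤ m := by
    apply hmono
    rintro ω ⟨hF, hcs⟩
    refine ⟨hF, ?_⟩
    rw [connT_eq]
    exact Or.inl (Or.inl hcs)
  have hf0 : 0 ≤ f := measureReal_nonneg
  have hd0 : 0 ≤ d := measureReal_nonneg
  have hfd : f ≤ d := hmono inter_subset_right
  rcases eq_or_lt_of_le hd0 with hd00 | hdpos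
  · have hf00 : f = 0 := le_antisymm (hd00 ▸ hfd) hf0
    rw [hf00, zero_mul]
    have : 0 ≤ m := measureReal_nonneg
    linarith
  · have h1 : f * (d * k) ≤ f * (2 * gS) := mul_le_mul_of_nonneg_left h hf0
    have h2 : f * (2 * gS) ≤ 2 * (m * d) := by nlinarith [hgain, hms_le, hd0]
    have h3 : d * (f * k) ≤ d * (2 * m) := by nlinarith [h1, h2]
    exact le_of_mul_le_mul_left h3 hdpos

omit [Fintype V] in
/-- `F` is symmetric in the root and its block partner: `(s↔a) ∩ (s↔b)ᶜ = (a↔s) ∩ (a↔b)ᶜ`. [this work] -/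
theorem F_symm (s a b : V) :
    (openConn s a ∩ (openConn s b)ᶜ : Set (BondConfig V)) = openConn a s ∩ (openConn a b)ᶜ := by
  ext ω
  simp only [mem_inter_iff, mem_compl_iff]
  constructor
  · rintro ⟨hsa, hsb⟩
    exact ⟨SimpleGraph.Reachable.symm hsa, fun hab => hsb (SimpleGraph.Reachable.trans hsa hab)⟩
  · rintro ⟨has, hab⟩
    exact ⟨SimpleGraph.Reachable.symm has, fun hsb => hab (SimpleGraph.Reachable.trans has hsb)⟩

omit [Fintype V] in
/-- `c ∤ T` is symmetric in `s` and `a`. [folklore] -/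
theorem nconnT_symm (s a b c : V) :
    ((openConn c s)ᶜ ∩ (openConn c a)ᶜ ∩ (openConn c b)ᶜ : Set (BondConfig V)) = (openConn c a)ᶜ ∩ (openConn c s)ᶜ ∩ (openConn c b)ᶜ := by
  rw [inter_comm (openConn c s)ᶜ]

/-- **`P3_{1/2}` at partner-sided ports (unconditional, every finite weighted graph).**  If `2·μ((a↮b) ∩ (c↔a)) ≥ μ(a↮b)·μ(c↔T)` then
`μ(F)·μ(c↔T) ≤ 2·μ(F ∩ c↔T)` — `p3_half_of_rootSided` with the roles of `s` and `a` exchanged (`F` and `c↔T` are symmetric). [this work] -/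
theorem p3_half_of_partnerSided (w : Sym2 V → unitInterval) (s a b c : V)
    (h : (prodBernoulli w).real ((openConn a b)ᶜ : Set (BondConfig V)) *
        (prodBernoulli w).real ((openConn c s)ᶜ ∩ (openConn c a)ᶜ ∩ (openConn c b)ᶜ : Set (BondConfig V))ᶜ ≤
      2 * (prodBernoulli w).real ((openConn a b)ᶜ ∩ openConn c a : Set (BondConfig V))) :
    (prodBernoulli w).real (openConn s a ∩ (openConn s b)ᶜ : Set (BondConfig V)) *
        (prodBernoulli w).real ((openConn c s)ᶜ ∩ (openConn c a)ᶜ ∩ (openConn c b)ᶜ : Set (BondConfig V))ᶜ ≤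
      2 * (prodBernoulli w).real (openConn s a ∩ (openConn s b)ᶜ ∩ ((openConn c s)ᶜ ∩ (openConn c a)ᶜ ∩ (openConn c b)ᶜ)ᶜ : Set (BondConfig V)) := by
  rw [nconnT_symm s a b c] at h ⊢
  rw [F_symm s a b]
  exact p3_half_of_rootSided w a s b c h


end Summit.CriticalPhenomena.PercolationContinuityZ3.Theorems.SuperTerminalP3HalfBHKSplit
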